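import Mathlib
import HarnessLib
import Summits.HubbardSuperconductivity.HubbardSuperconductivity.Theorems.BalabanIRBirGappedPhaseReductionRSlavedTrotterBlocks

/-!
# BalabanIR reduction `BirGappedPhaseReductionR` (stmt-14846): slaved BLOCK pair field — the Trotter limit and the fully slaved many-block weight

Support file (`--supports stmt-HubbardSuperconductivity-14846`; prover seat 2, session 11), fifth part
of the slaved pair-field dictionary (card `slaved-pair-field-os-dictionary`).  With `m` blocks
`B : Fin m → Mat_n(ℂ)`, penalty `H' = H + (κ/2)Σ_b (B_bB_bᴴ + B_bᴴB_b)`, single-block source slices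
`S_b(k) = e^{aκ(conj φ_k B_b + φ_k B_bᴴ)}`, `φ_k = r iᵏ`, `a = β/(M+1)`, `r² = (M+1)/(κβ)`:

* `tendsto_slavedProductBlocks` — **`m`-block slaved product formula**:
  `(e^{-aH'} Π_b ¼Σ_k S_b(k))^{M+1} → e^{-βH}` (matrix level; any `H`, any family `B`, `κ, β > 0`),
  from the `m`-block per-slice estimate (`…Blocks`) and Chernoff (`…ChernoffProductFormula`);
* `sum_slavedWeightBlocks_eq_pow` — **the fully slaved weight, summed**: the un-averaged weight of a
  space-time field configuration `P : Fin (M+1) → Fin m → Fin 4` is the ordered product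
  `Π_τ [e^{-aH'} Π_b S_b(P τ b)]`; its configuration average is EXACTLY the power of the averaged
  transfer matrix, `(1/4)^{m(M+1)} Σ_P Π_τ [e^{-aH'} Π_b S_b(P τ b)] = (e^{-aH'} Π_b S̄_b)^{M+1}`
  (distributivity of ordered products over configuration sums, twice);
* `tendsto_avg_slavedWeightBlocks_trace` — hence the configuration average of the traces of the
  fully slaved many-block weights converges to `tr e^{-βH}`: the block pair field is slaved EXACTLY in
  the Trotter limit, which is the representation the card's line starts from (with
  `H = hubbardTorus 2 L 1 U`, `B_b = blockPair L ℓ b`).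

Remark ((R) for blocks).  Each `S_b(k)` and `e^{-aH'}` is Hermitian (for Hermitian `H`), so the adjoint
of the weight of `P` is the weight of the time-REVERSED configuration with the block order reversed
inside each slice; with a palindromic block ordering the single-block statement
`slavedWeightTimeReflection` carries over verbatim.  Not needed below.
-/

noncomputable section

namespace Summit.HubbardSuperconductivity.HubbardSuperconductivity.Theorems

open scoped Matrix.Norms.L2Operator ComplexConjugate
open Matrix Filter Topology NormedSpace
open Literature.MathematicalPhysics.QuantumLattice

variable {n : Type*} [Fintype n] [DecidableEq n]

/-! ### The `m`-block product formula -/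

/-- **`m`-block slaved pair-field product formula (matrix form).** For any `H`, any family
`B : Fin m → Mat_n(ℂ)` and `κ, β > 0`:
`(e^{-a_M H'} · Π_b ¼Σ_{k<4} e^{a_Mκ(conj φ_k B_b + φ_k B_bᴴ)})^{M+1} → e^{-βH}`, `a_M = β/(M+1)`,
`φ_k = r_M iᵏ`, `r_M² = (M+1)/(κβ)`, `H' = H + (κ/2)Σ_b(B_bB_bᴴ + B_bᴴB_b)`. [folklore] -/
theorem tendsto_slavedProductBlocks (H : Matrix n n ℂ) {m : ℕ} (B : Fin m → Matrix n n ℂ) {κ β : ℝ}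
    (hκ : 0 < κ) (hβ : 0 < β) :
    Tendsto (fun M : ℕ =>
      (gibbsWeight (β / ((M : ℝ) + 1)) (H + ((κ / 2 : ℝ) : ℂ) • ∑ b, (B b * (B b)ᴴ + (B b)ᴴ * B b)) *
        (List.ofFn fun b => (1 / 4 : ℂ) • ∑ k : Fin 4, gibbsWeight (-(β / ((M : ℝ) + 1) * κ))
          (conj ((Real.sqrt (((M : ℝ) + 1) / (κ * β)) : ℂ) * Complex.I ^ (k : ℕ)) • B b +
            ((Real.sqrt (((M : ℝ) + 1) / (κ * β)) : ℂ) * Complex.I ^ (k : ℕ)) • (B b)ᴴ)).prod) ^ (M + 1))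
      atTop (𝓝 (gibbsWeight β H)) := by
  rcases isEmpty_or_nonempty n with hn | hn
  · have hsub : Subsingleton (Matrix n n ℂ) := inferInstance
    rw [show (fun M : ℕ =>
      (gibbsWeight (β / ((M : ℝ) + 1)) (H + ((κ / 2 : ℝ) : ℂ) • ∑ b, (B b * (B b)ᴴ + (B b)ᴴ * B b)) *
        (List.ofFn fun b => (1 / 4 : ℂ) • ∑ k : Fin 4, gibbsWeight (-(β / ((M : ℝ) + 1) * κ))
          (conj ((Real.sqrt (((M : ℝ) + 1) / (κ * β)) : ℂ) * Complex.I ^ (k : ℕ)) • B b +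
            ((Real.sqrt (((M : ℝ) + 1) / (κ * β)) : ℂ) * Complex.I ^ (k : ℕ)) • (B b)ᴴ)).prod) ^ (M + 1))
        = fun _ => gibbsWeight β H from funext fun _ => Subsingleton.elim _ _]
    exact tendsto_const_nhds
  obtain ⟨C, hC⟩ := exists_norm_slavedSliceBlocks_sub_gibbsWeight_le H hκ.le B
  obtain ⟨a, ha⟩ : ∃ a : ℕ → ℝ, ∀ M : ℕ, β / ((M : ℝ) + 1) = a M :=
    ⟨fun M => β / ((M : ℝ) + 1), fun _ => rfl⟩
  obtain ⟨r, hr⟩ : ∃ r : ℕ → ℝ, ∀ M : ℕ, Real.sqrt (((M : ℝ) + 1) / (κ * β)) = r M :=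
    ⟨fun M => Real.sqrt (((M : ℝ) + 1) / (κ * β)), fun _ => rfl⟩
  simp only [ha, hr]
  have hM : ∀ M : ℕ, (0 : ℝ) < (M : ℝ) + 1 := fun M => by positivity
  have ha0 : ∀ M, 0 < a M := fun M => by rw [← ha]; exact div_pos hβ (hM M)
  have hr0 : ∀ M, 0 ≤ r M := fun M => by rw [← hr]; exact Real.sqrt_nonneg _
  have hakr : ∀ M, a M * κ * r M ^ 2 = 1 := fun M => by
    rw [← hr, ← ha, Real.sq_sqrt (by positivity)]
    field_simp
  have ha_t : Tendsto a atTop (𝓝 0) := by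
    have e : a = fun M : ℕ => β * (1 / ((M : ℝ) + 1)) := funext fun M => by rw [← ha]; ring
    rw [e]
    simpa using (tendsto_one_div_add_atTop_nhds_zero_nat).const_mul β
  have ha1 : ∀ᶠ M : ℕ in atTop, a M ≤ 1 := ha_t.eventually (ge_mem_nhds one_pos)
  have hexact : ∀ M : ℕ, exp ((((M + 1 : ℕ) : ℂ))⁻¹ • (-(β : ℂ) • H)) = gibbsWeight (a M) H := by
    intro M
    rw [gibbsWeight, smul_smul, ← ha]
    congr 1
    push_cast
    field_simp
  have key := tendsto_pow_succ_of_norm_sub_exp_le (𝕂 := ℂ) (-(β : ℂ) • H)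
    (fun M : ℕ => gibbsWeight (a M) (H + ((κ / 2 : ℝ) : ℂ) • ∑ b, (B b * (B b)ᴴ + (B b)ᴴ * B b)) *
        (List.ofFn fun b => (1 / 4 : ℂ) • ∑ k : Fin 4, gibbsWeight (-(a M * κ))
          (conj (((r M : ℝ) : ℂ) * Complex.I ^ (k : ℕ)) • B b +
            (((r M : ℝ) : ℂ) * Complex.I ^ (k : ℕ)) • (B b)ᴴ)).prod)
    (fun M => C * (a M * (a M * κ * r M + a M))) ?_ ?_
  · rw [show gibbsWeight β H = exp (-(β : ℂ) • H) from rfl]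
    exact key
  · filter_upwards [ha1] with M hM1
    rw [hexact M]
    exact hC (a M) (r M) (ha0 M).le hM1 (hr0 M) (hakr M)
  · have hs : ∀ M, a M * κ * r M = Real.sqrt (κ * a M) := fun M => by
      have h2 : (a M * κ * r M) ^ 2 = κ * a M := by
        have e : (a M * κ * r M) ^ 2 = (a M * κ) * (a M * κ * r M ^ 2) := by ring
        rw [e, hakr M, mul_one, mul_comm]
      rw [← h2, Real.sqrt_sq (by have := (ha0 M).le; have := hr0 M; positivity)]
    have hs_t : Tendsto (fun M => a M * κ * r M) atTop (𝓝 0) := by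
      simp only [hs]
      simpa using (ha_t.const_mul κ).sqrt
    have hsum_t : Tendsto (fun M => C * β * (a M * κ * r M + a M)) atTop (𝓝 0) := by
      simpa using (hs_t.add ha_t).const_mul (C * β)
    refine hsum_t.congr fun M => ?_
    have e : ((M : ℝ) + 1) * a M = β := by rw [← ha]; field_simp
    calc C * β * (a M * κ * r M + a M) = C * (((M : ℝ) + 1) * a M) * (a M * κ * r M + a M) := by
          rw [e]
      _ = ((M : ℝ) + 1) * (C * (a M * (a M * κ * r M + a M))) := by ring

/-! ### The fully slaved many-block weight: its configuration average is the power of the averaged transfer matrix -/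

/-- **Configuration average of the fully slaved many-block weight.** For any `G` (think `e^{-aH'}`)
and single-block slice families `S : Fin m → Fin 4 → Mat_n(ℂ)`:
`(1/4)^{m(M+1)} • Σ_{P : Fin (M+1) → Fin m → Fin 4} Π_τ [G · Π_b S_b(P τ b)] = (G · Π_b ¼Σ_k S_b k)^{M+1}`
— distributivity of ordered products over configuration sums, in time and then in the blocks.
[folklore] -/
theorem sum_slavedWeightBlocks_eq_pow {m M : ℕ} (G : Matrix n n ℂ) (S : Fin m → Fin 4 → Matrix n n ℂ) :
    (1 / 4 : ℂ) ^ (m * (M + 1)) • ∑ P : Fin (M + 1) → Fin m → Fin 4,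
        (List.ofFn fun τ => G * (List.ofFn fun b => S b (P τ b)).prod).prod =
      (G * (List.ofFn fun b => (1 / 4 : ℂ) • ∑ k, S b k).prod) ^ (M + 1) := by
  -- time distributivity with `F τ p = (1/4)^m • (G * Π_b S_b (p b))`
  have h := sum_prod_ofFn_eq_prod_ofFn_sum
    (fun (_τ : Fin (M + 1)) (p : Fin m → Fin 4) => (1 / 4 : ℂ) ^ m • (G * (List.ofFn fun b => S b (p b)).prod))
  simp only [prod_ofFn_smul, ← Finset.smul_sum, ← pow_mul] at h
  rw [h, ← Finset.mul_sum, ← avg_config_prod_eq_prod_avg, mul_smul_comm, List.ofFn_const,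
    List.prod_replicate, smul_pow, ← pow_mul]

/-- **The block pair field is slaved exactly in the Trotter limit.** For any `H`, any family
`B : Fin m → Mat_n(ℂ)`, `κ, β > 0`: the configuration average of the traces of the fully slaved
many-block weights converges to the Gibbs trace,
`(1/4)^{m(M+1)} Σ_P tr Π_τ [e^{-a_M H'} Π_b S_b(P τ b)] → tr e^{-βH}` (`a_M = β/(M+1)`,
`S_b(k) = e^{a_Mκ(conj φ_k B_b + φ_k B_bᴴ)}`, `φ_k = r_M iᵏ`, `r_M² = (M+1)/(κβ)`). [folklore] -/
theorem tendsto_avg_slavedWeightBlocks_trace (H : Matrix n n ℂ) {m : ℕ} (B : Fin m → Matrix n n ℂ)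
    {κ β : ℝ} (hκ : 0 < κ) (hβ : 0 < β) :
    Tendsto (fun M : ℕ =>
      (1 / 4 : ℂ) ^ (m * (M + 1)) * ∑ P : Fin (M + 1) → Fin m → Fin 4,
        ((List.ofFn fun τ : Fin (M + 1) =>
          gibbsWeight (β / ((M : ℝ) + 1)) (H + ((κ / 2 : ℝ) : ℂ) • ∑ b, (B b * (B b)ᴴ + (B b)ᴴ * B b)) *
            (List.ofFn fun b => gibbsWeight (-(β / ((M : ℝ) + 1) * κ))
              (conj ((Real.sqrt (((M : ℝ) + 1) / (κ * β)) : ℂ) * Complex.I ^ ((P τ b : Fin 4) : ℕ)) • B b +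
                ((Real.sqrt (((M : ℝ) + 1) / (κ * β)) : ℂ) * Complex.I ^ ((P τ b : Fin 4) : ℕ)) •
                  (B b)ᴴ)).prod).prod).trace)
      atTop (𝓝 ((gibbsWeight β H).trace)) := by
  have hlim := ((continuous_id.matrix_trace).tendsto _).comp (tendsto_slavedProductBlocks H B hκ hβ)
  refine hlim.congr fun M => ?_
  simp only [Function.comp_apply, id]
  rw [← sum_slavedWeightBlocks_eq_pow, Matrix.trace_smul, Matrix.trace_sum, smul_eq_mul]

/-- **Registered form** (`stub_add`ed on stmt-14846 as `slavedBlockFieldTrotterExact`): the block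
pair field is slaved exactly in the Trotter limit — `tendsto_avg_slavedWeightBlocks_trace` with
all parameters universally quantified. [folklore] -/
theorem slavedBlockFieldTrotterExact : ∀ (n : Type) [Fintype n] [DecidableEq n] (H : Matrix n n ℂ) (m : ℕ) (B : Fin m → Matrix n n ℂ) (κ β : ℝ), 0 < κ → 0 < β → Filter.Tendsto (fun M : ℕ => (1 / 4 : ℂ) ^ (m * (M + 1)) * ∑ P : Fin (M + 1) → Fin m → Fin 4, ((List.ofFn fun τ : Fin (M + 1) => Matrix.gibbsWeight (β / ((M : ℝ) + 1)) (H + ((κ / 2 : ℝ) : ℂ) • ∑ b, (B b * Matrix.conjTranspose (B b) + Matrix.conjTranspose (B b) * B b)) * (List.ofFn fun b => Matrix.gibbsWeight (-(β / ((M : ℝ) + 1) * κ)) ((starRingEnd ℂ) ((Real.sqrt (((M : ℝ) + 1) / (κ * β)) : ℂ) * Complex.I ^ ((P τ b : Fin 4) : ℕ)) • B b + ((Real.sqrt (((M : ℝ) + 1) / (κ * β)) : ℂ) * Complex.I ^ ((P τ b : Fin 4) : ℕ)) • Matrix.conjTranspose (B b))).prod).prod).trace) Filter.atTop (nhds ((Matrix.gibbsWeight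 β H).trace)) :=
  fun _ _ _ H _ B _ _ hκ hβ => tendsto_avg_slavedWeightBlocks_trace H B hκ hβ

end Summit.HubbardSuperconductivity.HubbardSuperconductivity.Theorems

end
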